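import Mathlib
import Summits.Ventures.HodgeRepro2.T5FiniteZeros
import Summits.Ventures.HodgeRepro2.T5FiniteZerosCharacters
import Summits.Ventures.HodgeRepro2.T5AmiceInverse
import Summits.Ventures.HodgeRepro2.T5LambdaInvariantDVR

/-!
# T5FiniteZerosExtension — a `W`-valued measure kills at most `λ(f_m)` characters with values in ANY
complete domain over `W` (e.g. `𝒪_{ℂ_p}`): the characters of `Ξ_𝔭` live outside `W`

Cell pub-hodge-repro2, Tier 5 support (seat p7; route/T5-CHECK-G-p7.md §3 S5). S5's «ν ∈ Ξ_𝔭 with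
ν(γ₀) = ζ ∈ μ_{p^∞}: ∫ν dm = f_m(ζ − 1) (the ring map W[[Γ_𝔭]] → W[ζ], γ₀ ↦ ζ)» evaluates a `W`-valued
measure on characters whose values `ζ` lie in the EXTENSION `W[ζ] ⊂ 𝒪_{ℂ_p}`, not in `W`: the unramified
`W = W(𝔽̄_p)` (and `ℤ_p`) contains no non-trivial `p`-power roots of unity, so the `R`-valued characters of
T5FiniteZerosCharacters / T5LambdaInvariantDVR (with `R` the measure's own coefficient ring) miss exactly
the characters S5 is about — T5AmiceToy's `zeroSet_sub01 = {1}` shows `Ξ_𝔭(ℤ_p) = {1}`. This file extends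
scalars: for a measure `m` with values in `A` and a complete `A`-algebra `R'` (a domain, e.g. `𝒪_{ℂ_p}`),

* `extend m : C(ℤ_p, R') →ₗ[R'] R'` — the scalar extension `m ⊗ R'`, built from the coefficients
  `φ(m(x choose n))` by T5AmiceInverse's `ofCoeffs`; `amice_extend`: `f_{m ⊗ R'} = φ_*(f_m)`;
  `extend_comp`: `(m ⊗ R')(φ ∘ g) = φ(m g)` for `A`-valued `g` (it IS an extension); `extend_addChar`:
  `(m ⊗ R')(κ) = f_m(κ 1 − 1)` evaluated in `R'` — S5's formula with `ζ = κ 1 ∈ R'`;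
* `ncard_zeroSet_extend_le_lambdaSeries`: `#{κ : ℤ_p → R' continuous : (m ⊗ R')(κ) = 0} ≤ λ(f_m)` for
  `m ≠ 0` — S5's «|Z_i| ≤ deg P_i» with `Z_i ⊂ Ξ_𝔭` taken where it lives, the degree `λ(f_m)` computed over
  `W` (the Weierstrass polynomial `P ∈ W[T]` keeps its degree under `W → R'` and has at most `deg P` roots in
  the domain `R'`); `finite_zeroSet_extend`, `eventually_cofinite_extend_ne_zero`.

Hypotheses on `R'`: a complete ultrametric normed `ℤ_p`-algebra, linearly topologised, a domain, with an
`A`-algebra structure whose `algebraMap` is injective and norm-non-increasing (an isometric embedding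
`W ↪ 𝒪_{ℂ_p}` is one). Mathlib + own T5FiniteZerosCharacters (p8's T5FiniteZeros), T5AmiceInverse,
T5LambdaInvariantDVR only.
-/

namespace Summit.Ventures.HodgeRepro2.T5FiniteZerosExtension

open PadicInt Filter Topology
open Summit.Ventures.HodgeRepro2
open Summit.Ventures.HodgeRepro2.T5AmiceTransform
open Summit.Ventures.HodgeRepro2.T5AmiceInverse
open Summit.Ventures.HodgeRepro2.T5LambdaInvariantDVR
open scoped fwdDiff

variable {p : ℕ} [hp : Fact p.Prime]
variable {A : Type*} [NormedCommRing A] [Algebra ℤ_[p] A] [IsBoundedSMul ℤ_[p] A]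
variable {R' : Type*} [NormedCommRing R'] [Algebra ℤ_[p] R'] [IsBoundedSMul ℤ_[p] R']
  [IsUltrametricDist R'] [CompleteSpace R'] [Algebra A R']

/-! ### The scalar extension `m ⊗ R'` -/

omit [Algebra ℤ_[p] R'] [IsBoundedSMul ℤ_[p] R'] [IsUltrametricDist R'] [CompleteSpace R'] in
/-- The coefficients `φ(m(x choose n))` of the base-changed transform are bounded (for a bounded `m` and
a norm-non-increasing `φ = algebraMap A R'`). -/
theorem norm_algebraMap_coeff_le (m : C(ℤ_[p], A) →ₗ[A] A) {C : ℝ} (hb : ∀ f, ‖m f‖ ≤ C * ‖f‖)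
    (hφ : ∀ x : A, ‖algebraMap A R' x‖ ≤ ‖x‖) (n : ℕ) :
    ‖algebraMap A R' (PowerSeries.coeff n (amice m))‖ ≤ C * ‖(1 : A)‖ :=
  (hφ _).trans (norm_coeff_amice_le m C hb n)

/-- THE SCALAR EXTENSION `m ⊗ R' : C(ℤ_p, R') →ₗ[R'] R'` of a bounded `A`-valued measure `m`: the functional
whose Amice transform is `φ_*(f_m)` (T5AmiceInverse's `ofCoeffs` on the coefficients `φ(m(x choose n))`). -/
noncomputable def extend (m : C(ℤ_[p], A) →ₗ[A] A) {C : ℝ} (hb : ∀ f, ‖m f‖ ≤ C * ‖f‖)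
    (hφ : ∀ x : A, ‖algebraMap A R' x‖ ≤ ‖x‖) : C(ℤ_[p], R') →ₗ[R'] R' :=
  ofCoeffs p (fun n => algebraMap A R' (PowerSeries.coeff n (amice m)))
    (norm_algebraMap_coeff_le m hb hφ)

/-- `f_{m ⊗ R'} = φ_*(f_m)`. -/
theorem amice_extend (m : C(ℤ_[p], A) →ₗ[A] A) {C : ℝ} (hb : ∀ f, ‖m f‖ ≤ C * ‖f‖)
    (hφ : ∀ x : A, ‖algebraMap A R' x‖ ≤ ‖x‖) :
    amice (extend m hb hφ) = (amice m).map (algebraMap A R') := by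
  rw [extend, amice_ofCoeffs]
  ext n
  simp

/-- `m ⊗ R'` is bounded by `C‖1‖`. -/
theorem norm_extend_le (m : C(ℤ_[p], A) →ₗ[A] A) {C : ℝ} (hb : ∀ f, ‖m f‖ ≤ C * ‖f‖)
    (hφ : ∀ x : A, ‖algebraMap A R' x‖ ≤ ‖x‖) (g : C(ℤ_[p], R')) :
    ‖extend m hb hφ g‖ ≤ (C * ‖(1 : A)‖) * ‖g‖ :=
  norm_ofCoeffs_le _ _ g

/-- `m ⊗ R'` is continuous. -/
theorem continuous_extend (m : C(ℤ_[p], A) →ₗ[A] A) {C : ℝ} (hb : ∀ f, ‖m f‖ ≤ C * ‖f‖)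
    (hφ : ∀ x : A, ‖algebraMap A R' x‖ ≤ ‖x‖) : Continuous (extend m hb hφ) :=
  continuous_of_bound _ _ (norm_extend_le m hb hφ)

/-- `(m ⊗ R')(g) = Σ_n φ(m(x choose n)) · (Δⁿg)(0)` (the defining Mahler expansion). -/
theorem extend_apply (m : C(ℤ_[p], A) →ₗ[A] A) {C : ℝ} (hb : ∀ f, ‖m f‖ ≤ C * ‖f‖)
    (hφ : ∀ x : A, ‖algebraMap A R' x‖ ≤ ‖x‖) (g : C(ℤ_[p], R')) :
    extend m hb hφ g = ∑' n, algebraMap A R' (PowerSeries.coeff n (amice m)) *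
      (fwdDiff (1 : ℤ_[p]))^[n] (⇑g) 0 :=
  ofCoeffs_apply _ _ g

omit [Algebra ℤ_[p] A] [IsBoundedSMul ℤ_[p] A] [Algebra ℤ_[p] R'] [IsBoundedSMul ℤ_[p] R']
  [IsUltrametricDist R'] [CompleteSpace R'] in
/-- Forward differences commute with the additive map `φ`. -/
theorem fwdDiff_iter_comp_algebraMap (f : ℤ_[p] → A) (n : ℕ) (y : ℤ_[p]) :
    (fwdDiff (1 : ℤ_[p]))^[n] (fun x => algebraMap A R' (f x)) y =
      algebraMap A R' ((fwdDiff (1 : ℤ_[p]))^[n] f y) := by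
  rw [fwdDiff_iter_eq_sum_shift, fwdDiff_iter_eq_sum_shift, map_sum]
  refine Finset.sum_congr rfl fun k _ => ?_
  rw [map_zsmul]

/-- `m ⊗ R'` EXTENDS `m`: on `φ ∘ g` for an `A`-valued `g`, `(m ⊗ R')(φ ∘ g) = φ(m g)` (for a continuous
`φ`, e.g. norm-non-increasing). -/
theorem extend_comp [CompleteSpace A] [IsUltrametricDist A] (m : C(ℤ_[p], A) →ₗ[A] A) {C : ℝ}
    (hb : ∀ f, ‖m f‖ ≤ C * ‖f‖) (hφ : ∀ x : A, ‖algebraMap A R' x‖ ≤ ‖x‖)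
    (hφc : Continuous (algebraMap A R')) (g : C(ℤ_[p], A)) :
    extend m hb hφ (⟨fun x => algebraMap A R' (g x), hφc.comp g.continuous⟩ : C(ℤ_[p], R')) =
      algebraMap A R' (m g) := by
  rw [extend_apply, map_eq_tsum_fwdDiff m (continuous_of_bound m C hb) g]
  have h : ∀ n, algebraMap A R' (PowerSeries.coeff n (amice m)) *
      (fwdDiff (1 : ℤ_[p]))^[n] (fun x => algebraMap A R' (g x)) 0 =
      algebraMap A R' (((fwdDiff (1 : ℤ_[p]))^[n] (⇑g) 0) * m (mahlerTerm (1 : A) n)) := by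
    intro n
    rw [fwdDiff_iter_comp_algebraMap, map_mul, coeff_amice, mul_comm]
  simp only [ContinuousMap.coe_mk]
  rw [show (fun n => algebraMap A R' (PowerSeries.coeff n (amice m)) *
      (fwdDiff (1 : ℤ_[p]))^[n] (fun x => algebraMap A R' (g x)) 0) =
      fun n => algebraMap A R' (((fwdDiff (1 : ℤ_[p]))^[n] (⇑g) 0) * m (mahlerTerm (1 : A) n)) from
      funext h]
  have hs := hasSum_map_fwdDiff m (continuous_of_bound m C hb) g
  have hs' : HasSum (fun n => algebraMap A R' (((fwdDiff (1 : ℤ_[p]))^[n] (⇑g) 0) *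
      m (mahlerTerm (1 : A) n))) (algebraMap A R' (m g)) :=
    hs.map (algebraMap A R' : A →+ R') hφc
  rw [hs'.tsum_eq, hs.tsum_eq]

/-! ### Evaluation on `R'`-valued characters -/

variable [IsLinearTopology R' R']

/-- S5's formula for characters with values in the extension: `(m ⊗ R')(κ) = f_m(κ 1 − 1)`, the
evaluation of `φ_*(f_m)` at `ζ − 1 ∈ R'`. -/
theorem extend_addChar (m : C(ℤ_[p], A) →ₗ[A] A) {C : ℝ} (hb : ∀ f, ‖m f‖ ≤ C * ‖f‖)
    (hφ : ∀ x : A, ‖algebraMap A R' x‖ ≤ ‖x‖) (κ : AddChar ℤ_[p] R') (hκ : Continuous κ) :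
    extend m hb hφ ⟨κ, hκ⟩ =
      PowerSeries.aeval (hasEval_eval_one_sub_one κ hκ) ((amice m).map (algebraMap A R')) := by
  rw [← amice_extend m hb hφ, aeval_amice_eq_map _ (continuous_extend m hb hφ) κ hκ]

/-! ### The count `#Z ≤ λ(f_m)` in the extension -/

section Count

variable [IsDomain R'] [IsDomain A] [IsDiscreteValuationRing A]
  [IsAdicComplete (IsLocalRing.maximalIdeal A) A]

omit [IsUltrametricDist R'] [CompleteSpace R'] [IsLinearTopology R' R'] [IsDomain A]
  [IsDiscreteValuationRing A] [IsAdicComplete (IsLocalRing.maximalIdeal A) A] in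
/-- An evaluation killing `φ_*(f)` with `f = C c · (P · U)` (`U` a unit, `c ≠ 0`, `φ` injective) sends `X` to
a root of `P.map φ` — p8's `isRoot_of_eval_eq_zero` after base change. -/
theorem isRoot_map_of_aeval_map_eq_zero (hφi : Function.Injective (algebraMap A R')) {f : PowerSeries A}
    {c : A} (hc : c ≠ 0) {P : Polynomial A} {U : PowerSeries A} (hU : IsUnit U)
    (hf : f = PowerSeries.C c * (↑P * U)) (ev : PowerSeries R' →ₐ[R'] R')
    (h : ev (f.map (algebraMap A R')) = 0) : (P.map (algebraMap A R')).IsRoot (ev PowerSeries.X) := by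
  have hc' : algebraMap A R' c ≠ 0 := fun h0 => hc (hφi (by rw [h0, map_zero]))
  have hf' : f.map (algebraMap A R') =
      PowerSeries.C (algebraMap A R' c) * (↑(P.map (algebraMap A R')) * U.map (algebraMap A R')) := by
    rw [hf, map_mul, map_mul, PowerSeries.map_C, Polynomial.polynomial_map_coe]
  exact T5FiniteZeros.isRoot_of_eval_eq_zero hc' (hU.map (PowerSeries.map (algebraMap A R'))) hf' ev h

/-- S5's COUNT, SCALARS EXTENDED: for a bounded `m ≠ 0` with values in the complete DVR `A` (the Katz
measure's `W`) and characters with values in a complete domain `R'` over `A` (`𝒪_{ℂ_p}`, where `Ξ_𝔭` lives),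
`#{κ : ℤ_p → R' continuous : (m ⊗ R')(κ) = 0} ≤ λ(f_m)`, with `λ(f_m)` computed over `A`. -/
theorem ncard_zeroSet_extend_le_lambdaSeries (m : C(ℤ_[p], A) →ₗ[A] A) {C : ℝ}
    (hb : ∀ f, ‖m f‖ ≤ C * ‖f‖) (hφ : ∀ x : A, ‖algebraMap A R' x‖ ≤ ‖x‖)
    (hφi : Function.Injective (algebraMap A R')) [IsUltrametricDist A] [CompleteSpace A]
    (hne : m ≠ 0) :
    {κ : {κ : AddChar ℤ_[p] R' // Continuous κ} | extend m hb hφ ⟨κ.1, κ.2⟩ = 0}.ncard ≤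
      lambdaSeries (amice m) := by
  obtain ⟨ϖ, hϖ⟩ := IsDiscreteValuationRing.exists_irreducible A
  have hf : amice m ≠ 0 := (amice_ne_zero_iff m (continuous_of_bound m C hb)).mpr hne
  obtain ⟨k, P, U, -, hP, hU, hdeg, hfact⟩ := exists_weierstrass hϖ hf
  have hc : ϖ ^ k ≠ 0 := pow_ne_zero _ hϖ.ne_zero
  set P' := P.map (algebraMap A R') with hP'
  have hP'0 : P' ≠ 0 := by
    rw [hP']
    exact Polynomial.map_ne_zero_iff hφi |>.mpr hP.monic.ne_zero
  have hdeg' : P'.natDegree = P.natDegree := Polynomial.natDegree_map_eq_of_injective hφi P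
  classical
  have hsub : ∀ κ ∈ {κ : {κ : AddChar ℤ_[p] R' // Continuous κ} | extend m hb hφ ⟨κ.1, κ.2⟩ = 0},
      κ.1 1 - 1 ∈ (↑P'.roots.toFinset : Set R') := by
    intro κ hκ
    simp only [Set.mem_setOf_eq] at hκ
    rw [Finset.mem_coe, Multiset.mem_toFinset, Polynomial.mem_roots hP'0]
    rw [extend_addChar m hb hφ κ.1 κ.2] at hκ
    have h := isRoot_map_of_aeval_map_eq_zero hφi hc hU hfact
      (PowerSeries.aeval (hasEval_eval_one_sub_one κ.1 κ.2)) hκ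
    rwa [T5FiniteZerosCharacters.aeval_X_eq] at h
  calc {κ : {κ : AddChar ℤ_[p] R' // Continuous κ} | extend m hb hφ ⟨κ.1, κ.2⟩ = 0}.ncard
      ≤ (↑P'.roots.toFinset : Set R').ncard :=
        Set.ncard_le_ncard_of_injOn _ hsub
          (T5PadicFiniteOrderCharacters.eval_one_sub_one_injective.injOn) (Finset.finite_toSet _)
    _ = P'.roots.toFinset.card := Set.ncard_coe_finset _
    _ ≤ P'.roots.card := Multiset.toFinset_card_le _
    _ ≤ P'.natDegree := Polynomial.card_roots' P'
    _ = P.natDegree := hdeg'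
    _ = lambdaSeries (amice m) := hdeg

/-- The extended zero set is finite. -/
theorem finite_zeroSet_extend (m : C(ℤ_[p], A) →ₗ[A] A) {C : ℝ}
    (hb : ∀ f, ‖m f‖ ≤ C * ‖f‖) (hφ : ∀ x : A, ‖algebraMap A R' x‖ ≤ ‖x‖)
    (hφi : Function.Injective (algebraMap A R')) [IsUltrametricDist A] [CompleteSpace A]
    (hne : m ≠ 0) :
    {κ : {κ : AddChar ℤ_[p] R' // Continuous κ} | extend m hb hφ ⟨κ.1, κ.2⟩ = 0}.Finite := by
  obtain ⟨ϖ, hϖ⟩ := IsDiscreteValuationRing.exists_irreducible A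
  have hf : amice m ≠ 0 := (amice_ne_zero_iff m (continuous_of_bound m C hb)).mpr hne
  obtain ⟨k, P, U, -, hP, hU, -, hfact⟩ := exists_weierstrass hϖ hf
  have hc : ϖ ^ k ≠ 0 := pow_ne_zero _ hϖ.ne_zero
  have hP'0 : P.map (algebraMap A R') ≠ 0 :=
    Polynomial.map_ne_zero_iff hφi |>.mpr hP.monic.ne_zero
  classical
  refine ((Finset.finite_toSet (P.map (algebraMap A R')).roots.toFinset).preimage
    (T5PadicFiniteOrderCharacters.eval_one_sub_one_injective.injOn)).subset ?_
  intro κ hκ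
  simp only [Set.mem_setOf_eq] at hκ
  rw [Set.mem_preimage, Finset.mem_coe, Multiset.mem_toFinset, Polynomial.mem_roots hP'0]
  rw [extend_addChar m hb hφ κ.1 κ.2] at hκ
  have h := isRoot_map_of_aeval_map_eq_zero hφi hc hU hfact
    (PowerSeries.aeval (hasEval_eval_one_sub_one κ.1 κ.2)) hκ
  rwa [T5FiniteZerosCharacters.aeval_X_eq] at h

/-- `(m ⊗ R')(κ) ≠ 0` for all but finitely many continuous `R'`-valued characters `κ` — S5's conclusion
for `Ξ_𝔭` where it lives. -/
theorem eventually_cofinite_extend_ne_zero (m : C(ℤ_[p], A) →ₗ[A] A) {C : ℝ}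
    (hb : ∀ f, ‖m f‖ ≤ C * ‖f‖) (hφ : ∀ x : A, ‖algebraMap A R' x‖ ≤ ‖x‖)
    (hφi : Function.Injective (algebraMap A R')) [IsUltrametricDist A] [CompleteSpace A]
    (hne : m ≠ 0) :
    ∀ᶠ κ : {κ : AddChar ℤ_[p] R' // Continuous κ} in cofinite, extend m hb hφ ⟨κ.1, κ.2⟩ ≠ 0 := by
  rw [Filter.eventually_cofinite]
  simpa only [not_not] using finite_zeroSet_extend m hb hφ hφi hne

end Count

end Summit.Ventures.HodgeRepro2.T5FiniteZerosExtension
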